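import Mathlib.Analysis.Complex.Basic
import Literature.NumberTheory.Transcendental.KZCalculus
import Literature.NumberTheory.Transcendental.SemialgebraicMapsProofs
import HarnessLib

/-!
# Hermitian hitting representations in `ℂ²`

Definition request `defn-HermitianHittingRep` (route KontsevichZagierPeriods/KinematicFormulas, informal
crux `UnitaryKinematicC2`). The affine unitary group `U(2) ⋉ ℂ²` acts on the real affine subspaces of
`ℂ² = ℝ⁴`; the route needs, for each of the five orbit types `A` entering the hermitian kinematic
formulas of `ℂ²` —

* points (`A = pt`, the volume term),
* real lines (one `U(2)`-orbit, `Gr₁ = Gr_{1,0}`),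
* complex affine lines (`Gr_{2,1}`),
* affine Lagrangian planes (`Gr_{2,0}`, the Lagrangian Grassmannian `U(2)/O(2)`),
* real hyperplanes (one orbit, `Gr₃ = Gr_{3,1}`)

(notation `Gr_{k,p}` of Bernig–Fu 2011, §2.2) — three pieces of data, all `ℚ`-semialgebraic and with
RATIONAL densities, so that the *hitting integral* `μ_A(K) = m_A{E : E ∩ K ≠ ∅}` is the value of an
integral representation of the Kontsevich–Zagier calculus
(`Literature.NumberTheory.Transcendental.KZ.IntegralRep`):

1. a chart: parameters `x ∈ chart_A ⊆ ℝ^d` and the affine subspace `carrier_A x ⊆ ℝ⁴` they name,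
   injective on `chart_A` onto an open dense (co-null) subset of the homogeneous space;
2. the density `density_A : ℝ^d → ℝ` of the `U(2) ⋉ ℂ²`-invariant measure in that chart, with a
   stated normalisation;
3. the hitting set `hit_A K = {x ∈ chart_A | ∃ q ∈ K, q ∈ carrier_A x} ⊆ ℝ^d`.

A `HermitianHittingRep K` is then a choice, for each of the five types, of an integral
representation with domain `hit_A K` and integrand `density_A` — exactly the shape in which
`LineHit`/`Inc` are quantified over in the route file
`Summits/KontsevichZagierPeriods/KontsevichZagierPeriods/Theses/KinematicFormulas.lean`.

## Conventions (matching `UnitaryDiscPair` of that route)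

* `ℝ⁴ = ℂ²`: `q : Fin 4 → ℝ ↦ (z₁, z₂) = (q 0 + i q 1, q 2 + i q 3)` (`zfst`, `zsnd`).
* `S³ ⊂ ℂ²` by inverse stereographic projection of `w ∈ ℝ³`:
  `(α, β) = ((2w₀ + 2w₁ i)/D, (2w₂ + (|w|² − 1) i)/D)`, `D = 1 + |w|²`; the round measure of `S³`
  is `(2/D)³ dw = 8/D³ dw` (total mass `2π²`), and `{|w| < 1} = {Im β < 0}` is an open hemisphere
  (mass `π²`, a chart of `ℝP³` up to a null set).
* Real inner product `⟨u, v⟩ = Re Σ uₖ v̄ₖ`; for `v = (α, β) ∈ S³` the frame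
  `(v, iv, Jv, iJv)`, `Jv = (−β̄, ᾱ)`, is orthonormal; `ℂv = span(v, iv)`, `(ℂv)^⊥ = span(Jv, iJv)`.

## The five charts, densities, normalisations and value checks

Throughout `B⁴` is the closed unit ball, `D_ℂ = {(z, 0) : |z| ≤ 1}` the unit disc of the complex line
`ℂe₁` and `D_ℝ = {(a, b) : a, b ∈ ℝ, a² + b² ≤ 1}` the unit disc of the Lagrangian plane `ℝ² ⊂ ℂ²`.
`O_k` is the area of the unit `k`-sphere (`O₀ = 2, O₁ = 2π, O₂ = 4π, O₃ = 2π²`).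

* `Point` (`d = 4`): `carrier x = {x}`, chart `ℝ⁴`, density `1` (Lebesgue measure = the
  translation part of the Haar measure in the convention of Bernig–Fu 2011, §2.4).
  `μ_pt(K) = vol₄ K`; `μ_pt(B⁴) = π²/2`.
* `RealLine` (`d = 6`, `x = (w, c) ∈ ℝ³ × ℝ³`): the line `ℝ v + c₁ iv + c₂ Jv + c₃ iJv`,
  `v = (α, β)(w)`, i.e. `carrier x = {q | ⟨q, iv⟩ = c₁, ⟨q, Jv⟩ = c₂, ⟨q, iJv⟩ = c₃}` (denominators
  cleared by `D > 0`); chart `{|w| < 1} × ℝ³` (each unoriented line with `Im β ≠ 0` exactly once);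
  density `8/D³` = (round measure on the hemisphere, i.e. the measure of `ℝP³` of total mass
  `π² = O₃/2`) ⊗ (Lebesgue measure on `v^⊥` in the orthonormal frame): Santaló's
  `dL₁ = dσ₃ ∧ du₃` [Santaló 2004, (12.39)]. Check: `μ(lines meeting B⁴) = π² · (4π/3) = 4π³/3`,
  which is (14.1) of Santaló 2004 for `n = 4, r = 1`: `(4 O₂ /(3 O₀)) W₁(B⁴) = (8π/3)(π²/2)`.
* `ComplexLine` (`d = 4`, `x = (m, c) ∈ ℂ × ℂ`): the line `{z₂ = m z₁ + c}`; chart `ℝ⁴` (all complex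
  lines not parallel to `ℂe₂`); density `(1 + |m|²)⁻³` = (Fubini–Study area of `ℂP¹ ∋ [1 : m]`,
  `dm/(1+|m|²)²`, total mass `π`) ⊗ (Lebesgue measure on the orthogonal complex line; the intercept
  `c` carries the Jacobian `(1+|m|²)⁻¹`). Checks: `μ(B⁴) = ∫ π(1+|m|²) (1+|m|²)⁻³ dm = π²`;
  `μ(D_ℂ) = ∫ π|m|² (1+|m|²)⁻³ dm = π²/2`; `μ(D_ℝ) = ∫ π|Im m| (1+|m|²)⁻³ dm = π²/4` — the ratio
  `2 : 1` is the pair of Haar means `1/2, 1/4` of `UnitaryDiscPair`. Dividing by `π` gives the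
  probability normalisation of the `U(2)`-invariant Crofton measure `ν_{2,1}` of Bernig–Fu 2011, §4.
* `LagrangianPlane` (`d = 5`, `x = (s₁, s₂, s₃, c) ∈ ℝ³ × ℝ²`, `S = [[s₁, s₂], [s₂, s₃]]`): the
  plane `{u + i(Su + c) : u ∈ ℝ²}`, i.e. `Im z = S Re z + c` (Lagrangian iff `S` symmetric); chart
  `ℝ⁵` (all affine Lagrangian planes transversal to `iℝ²`, a co-null open set); density
  `det(1 + S²)⁻² = ((1 − s₁s₃ + s₂²)² + (s₁ + s₃)²)⁻²` = (the `U(2)`-invariant measure on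
  `Λ(2) = U(2)/O(2)` of total mass `π²`, density `det(1+S²)^{-3/2}` in the graph chart) ⊗ (Lebesgue
  measure on `L^⊥ = iL`; the offset `c` carries the Jacobian `det(1+S²)^{-1/2}`).
  DERIVATION (not in the cited sources in this form): `Λ(2)` is the space of symmetric unitary
  matrices `W = u uᵀ` (`L = uℝ² = {v | v = W v̄}`), the graph chart is the Cayley transform
  `W = (1 + iS)(1 − iS)⁻¹`, the invariant metric `tr(dW dW*)` equals `4 tr((1+S²)⁻¹dS (1+S²)⁻¹dS)`
  with Riemannian density `8√2 det(1+S²)^{-3/2} ds₁ds₂ds₃` (the Cauchy measure: Cayley image of the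
  Haar measure of `U(n)/O(n)` has density `∝ det(1+S²)^{-(n+1)/2}`, here `n = 2`). EXACT checks in
  eigen-coordinates `dS = |λ₁ − λ₂| dλ dθ`: `∫_{ℝ³} det(1+S²)^{-3/2} dS = (π/2)·∫∫ |sin(a−b)| da db = π²`;
  `μ(B⁴) = π ∫ det(1+S²)^{-3/2} = π³`; `μ(D_ℂ) = π ∫ |s₂| det(1+S²)⁻² dS = π³/4`;
  `μ(D_ℝ) = π ∫ |det S| det(1+S²)⁻² dS = 3π³/8`. The last two, divided by `π³`, are the Haar means
  `E|Im(αβ̄)| = 1/4` and `E|Re α Re(λᾱ) + Re β Re(λβ̄)| = 3/8` over `u = [[α, −λβ̄], [β, λᾱ]] ∈ U(2)`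
  (the chart of `UnitaryDiscPair`; Monte-Carlo `0.2499`, `0.3751`), i.e. the chart-side and
  group-side computations of `∫_{Λ(2)} |cos(E, L)| dL` agree for `E` complex and `E` Lagrangian —
  the certificate of invariance and normalisation recorded with the definition request. Dividing
  by `π²` gives the probability normalisation (`ν_{2,0}` of Bernig–Fu 2011, §4). The Klain
  functions of `μ_ComplexLine/π` and `μ_LagrangianPlane/π²` take the values `(1/2, 1/4)` and
  `(1/4, 3/8)` on (complex, Lagrangian) planes; the determinant `1/8 ≠ 0` shows that the two
  degree-2 hitting valuations are linearly independent in the 2-dimensional `Val₂^{U(2)}`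
  (Bernig–Fu 2011, Thm. 3.2 with `n = 2`).
* `RealHyperplane` (`d = 4`, `x = (w, p) ∈ ℝ³ × [0, ∞)`): the hyperplane `{q | ⟨q, v(w)⟩ = p}` with
  unit normal `v(w) ∈ S³` and distance `p ≥ 0` (denominators cleared by `D`); chart `{0 ≤ p}` (all
  normals but the pole `(0, i)`; hyperplanes through `0` twice, a null set — the convention of
  `LineHit` in the plane engine of the route); density `8/D³` = (round measure of `S³`, mass `2π²`)
  ⊗ `dp`: Santaló's `dL₃ = dρ ∧ du₃` [Santaló 2004, (12.40)]. Check: `μ(hyperplanes meeting B⁴) =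
  2π² · 1 = 2π²` = (14.1) of Santaló 2004 for `n = 4, r = 3`: `4 W₃(B⁴) = 4 · π²/2`; in general
  `μ(K) = (1/2)∫_{S³} width_K = π² ·` (mean width).

## Main definitions

* `C2.hitSet chart carrier K` — generic hitting set; `C2.<Type>.carrier/chart/density/hit` for
  `Type ∈ {Point, RealLine, ComplexLine, LagrangianPlane, RealHyperplane}`.
* `C2.HermitianHittingRep K` — the five integral representations `[hit_A K, density_A]`.

## Main statements (all proved)

* `C2.isSemialgebraic_hitSet` and `C2.<Type>.isSemialgebraic_hit` — for `ℚ`-semialgebraic `K` every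
  hitting set is `ℚ`-semialgebraic (Tarski–Seidenberg, `IsSemialgebraic.image_castAdd`, proved in
  tree), and `C2.<Type>.isSemialgebraicFunOn_density` — the densities are `ℚ`-semialgebraic
  (rational) functions on every `ℚ`-semialgebraic set; so the two semialgebraicity fields of an
  `IntegralRep` with domain `hit_A K` and integrand `density_A` are available to provers
  (integrability is body-dependent and left to them);
* `C2.<Type>.mem_carrier_iff`, `mem_hit_iff`, the normalised forms
  `ComplexLine.mem_carrier_iff_complex`, `RealLine.mem_carrier_iff_complex`,
  `RealHyperplane.mem_carrier_iff_unit`, `normSq_stereoAlpha_add_normSq_stereoBeta`, positivity of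
  the densities (`LagrangianPlane.det_pos`), `Point.hit_eq`, `HermitianHittingRep.point_value`
  (`= vol₄ K`), `HermitianHittingRep.isSemialgebraic`.
* Correspondence with Bernig–Fu's `ν_{k,p}` (valuation with `U(2)`-invariant probability Crofton
  measure on `Gr_{k,p}`), for convex `K`: `μ_RealLine = π² ν_{3,1}`, `μ_ComplexLine = π ν_{2,1}`,
  `μ_LagrangianPlane = π² ν_{2,0}`, `μ_RealHyperplane = π² ν_{1,0}` (`E ↦ E^⊥` exchanges the hitting
  family with the Crofton family: `(ℝv)^⊥ ∈ Gr_{3,1}`, `(ℂ-line)^⊥ ∈ Gr_{2,1}`, `L^⊥ = iL ∈ Gr_{2,0}`,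
  `H^⊥ ∈ Gr_{1,0}`), stated in docstrings only.

## References

* A. Bernig, J. H. G. Fu, *Hermitian integral geometry*, Ann. of Math. 173 (2011), §2.2
  (`Gr_{k,p}`), §2.4 (normalisation of `dḡ`), §3.1–3.2, §4 (`ν_{k,p}`). [BernigFu2011]
* L. A. Santaló, *Integral Geometry and Geometric Probability*, 2nd ed. (2004), §12.2 (12.18),
  §12.5 (12.38)–(12.40), §14.1 (14.1). [SantaloKac2004]
* S. Alesker, *Hard Lefschetz theorem for valuations, complex integral geometry, and unitarily
  invariant valuations*, J. Differential Geom. 63 (2003) (`dim Val^{U(2)} = 6`). [Alesker2003]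
* R. Howard, *The kinematic formula in Riemannian homogeneous spaces*, Mem. AMS 509 (1993). [Howard1993]

## Design notes / what is NOT here

* Carriers are written as explicit polynomial equations in `(x, q)` (denominators `D = 1 + |w|² > 0`
  cleared), so that hitting sets are visibly projections of semialgebraic sets; the normalised
  (complex) forms are lemmas.
* No invariance theorem for the densities is proved here (it is a change-of-variables computation,
  i.e. route work inside the calculus); the densities are DATA with the derivations and exact value
  checks above. No existence theorem `Nonempty (HermitianHittingRep K)` is proved (it needs the
  integrability estimates `∫ (1+|m|²)⁻³ · O(1+|m|)² < ∞`, `∫ det(1+S²)⁻² · O(det(1+S²)^{1/2}) < ∞`).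
* Only the five orbit types of the request: 2-planes of intermediate Kähler angle, and the
  one-point space `{ℂ²}` (the Euler-characteristic term `χ ⊗ vol`), are not parametrised.
-/

noncomputable section

open Set MvPolynomial MeasureTheory

namespace Literature.Geometry.IntegralGeometry

namespace C2

open _root_.Literature.ModelTheory.ExponentialFields (IsSemialgebraic
  isSemialgebraic_setOf_eval_eq_zero isSemialgebraic_setOf_eval_pos
  isSemialgebraic_setOf_eval_nonneg isSemialgebraic_univ)
open _root_.Literature.NumberTheory.Transcendental

/-! ### Coordinates -/

/-- First complex coordinate of `q ∈ ℝ⁴ = ℂ²`: `z₁ = q 0 + i q 1`. [folklore] -/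
def zfst (q : Fin 4 → ℝ) : ℂ := ⟨q 0, q 1⟩

/-- Second complex coordinate of `q ∈ ℝ⁴ = ℂ²`: `z₂ = q 2 + i q 3`. [folklore] -/
def zsnd (q : Fin 4 → ℝ) : ℂ := ⟨q 2, q 3⟩

/-- `D(w) = 1 + |w|²`, the common denominator of the inverse stereographic chart of `S³`
(`w = (x 0, x 1, x 2)` are the first three parameters). [folklore] -/
def stereoDen {d : ℕ} (x : Fin (d + 3) → ℝ) : ℝ := 1 + x 0 ^ 2 + x 1 ^ 2 + x 2 ^ 2

/-- First component `α = (2w₀ + 2w₁ i)/D` of the point `(α, β) ∈ S³ ⊂ ℂ²` with stereographic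
coordinate `w = (x 0, x 1, x 2)` (the chart of `UnitaryDiscPair`). [folklore] -/
def stereoAlpha {d : ℕ} (x : Fin (d + 3) → ℝ) : ℂ :=
  ⟨2 * x 0 / stereoDen x, 2 * x 1 / stereoDen x⟩

/-- Second component `β = (2w₂ + (|w|² − 1) i)/D` of the point `(α, β) ∈ S³ ⊂ ℂ²` with
stereographic coordinate `w = (x 0, x 1, x 2)`. [folklore] -/
def stereoBeta {d : ℕ} (x : Fin (d + 3) → ℝ) : ℂ :=
  ⟨2 * x 2 / stereoDen x, (x 0 ^ 2 + x 1 ^ 2 + x 2 ^ 2 - 1) / stereoDen x⟩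

/-- `D(w) = 1 + |w|² > 0`. [folklore] -/
theorem stereoDen_pos {d : ℕ} (x : Fin (d + 3) → ℝ) : 0 < stereoDen x := by
  unfold stereoDen; positivity

/-- `(α, β)(w)` lies on the unit sphere: `|α|² + |β|² = 1`. [folklore] -/
theorem normSq_stereoAlpha_add_normSq_stereoBeta {d : ℕ} (x : Fin (d + 3) → ℝ) :
    Complex.normSq (stereoAlpha x) + Complex.normSq (stereoBeta x) = 1 := by
  have hD := (stereoDen_pos x).ne'
  simp only [stereoAlpha, stereoBeta, Complex.normSq_mk]
  field_simp
  unfold stereoDen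
  ring

/-! ### Generic hitting sets -/

/-- The hitting set of a body `K ⊆ ℝ⁴` for a parametrised family of subsets: the parameters
`x ∈ chart` whose member `carrier x` meets `K`, `{x ∈ chart | ∃ q ∈ K, q ∈ carrier x}`.
[folklore] -/
def hitSet {d : ℕ} (chart : Set (Fin d → ℝ)) (carrier : (Fin d → ℝ) → Set (Fin 4 → ℝ))
    (K : Set (Fin 4 → ℝ)) : Set (Fin d → ℝ) :=
  {x | x ∈ chart ∧ ∃ q ∈ K, q ∈ carrier x}

/-- Membership in a hitting set. [folklore] -/
theorem mem_hitSet_iff {d : ℕ} {chart : Set (Fin d → ℝ)} {carrier : (Fin d → ℝ) → Set (Fin 4 → ℝ)}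
    {K : Set (Fin 4 → ℝ)} {x : Fin d → ℝ} :
    x ∈ hitSet chart carrier K ↔ x ∈ chart ∧ ∃ q ∈ K, q ∈ carrier x := Iff.rfl

/-- Hitting sets are monotone in the body. [folklore] -/
theorem hitSet_mono {d : ℕ} (chart : Set (Fin d → ℝ)) (carrier : (Fin d → ℝ) → Set (Fin 4 → ℝ))
    {K K' : Set (Fin 4 → ℝ)} (h : K ⊆ K') : hitSet chart carrier K ⊆ hitSet chart carrier K' :=
  fun _ ⟨hx, q, hq, hqx⟩ => ⟨hx, q, h hq, hqx⟩

/-- The hitting set of the empty body is empty. [folklore] -/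
@[simp] theorem hitSet_empty {d : ℕ} (chart : Set (Fin d → ℝ))
    (carrier : (Fin d → ℝ) → Set (Fin 4 → ℝ)) : hitSet chart carrier ∅ = ∅ := by
  ext x; simp [hitSet]

/-- The hitting set of a union is the union of the hitting sets. [folklore] -/
theorem hitSet_union {d : ℕ} (chart : Set (Fin d → ℝ)) (carrier : (Fin d → ℝ) → Set (Fin 4 → ℝ))
    (K K' : Set (Fin 4 → ℝ)) :
    hitSet chart carrier (K ∪ K') = hitSet chart carrier K ∪ hitSet chart carrier K' := by
  ext x
  simp only [hitSet, mem_setOf_eq, mem_union]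
  constructor
  · rintro ⟨hx, q, hq | hq, hqx⟩
    · exact Or.inl ⟨hx, q, hq, hqx⟩
    · exact Or.inr ⟨hx, q, hq, hqx⟩
  · rintro (⟨hx, q, hq, hqx⟩ | ⟨hx, q, hq, hqx⟩)
    · exact ⟨hx, q, Or.inl hq, hqx⟩
    · exact ⟨hx, q, Or.inr hq, hqx⟩

/-- A hitting set is contained in the chart. [folklore] -/
theorem hitSet_subset_chart {d : ℕ} (chart : Set (Fin d → ℝ))
    (carrier : (Fin d → ℝ) → Set (Fin 4 → ℝ)) (K : Set (Fin 4 → ℝ)) :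
    hitSet chart carrier K ⊆ chart := fun _ hx => hx.1

/-- **Hitting sets are semialgebraic** (Tarski–Seidenberg). If the chart is `ℚ`-semialgebraic, the
incidence relation `{(x, q) | q ∈ carrier x} ⊆ ℝ^(d+4)` is `ℚ`-semialgebraic and the body `K` is
`ℚ`-semialgebraic, then `hitSet chart carrier K` — the projection to `ℝ^d` of
`(chart × K) ∩ incidence` — is `ℚ`-semialgebraic.
[cite: BochnakCosteRoy1998, Thm. 2.2.1] -/
theorem isSemialgebraic_hitSet {d : ℕ} {chart : Set (Fin d → ℝ)}
    {carrier : (Fin d → ℝ) → Set (Fin 4 → ℝ)} {K : Set (Fin 4 → ℝ)}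
    (hchart : IsSemialgebraic ℚ chart)
    (hinc : IsSemialgebraic ℚ {u : Fin (d + 4) → ℝ |
      (fun j : Fin 4 => u (Fin.natAdd d j)) ∈ carrier (fun i : Fin d => u (Fin.castAdd 4 i))})
    (hK : IsSemialgebraic ℚ K) :
    IsSemialgebraic ℚ (hitSet chart carrier K) := by
  have hW : IsSemialgebraic ℚ
      (((fun u : Fin (d + 4) → ℝ => u ∘ Fin.castAdd 4) ⁻¹' chart) ∩
        (((fun u : Fin (d + 4) → ℝ => u ∘ Fin.natAdd d) ⁻¹' K) ∩
          {u : Fin (d + 4) → ℝ |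
            (fun j : Fin 4 => u (Fin.natAdd d j)) ∈ carrier (fun i : Fin d => u (Fin.castAdd 4 i))})) :=
    (hchart.preimage_comp (Fin.castAdd 4)).inter ((hK.preimage_comp (Fin.natAdd d)).inter hinc)
  convert hW.image_castAdd using 1
  ext x
  simp only [hitSet, mem_setOf_eq, mem_image, mem_inter_iff, mem_preimage, Function.comp_def]
  constructor
  · rintro ⟨hx, q, hq, hqx⟩
    refine ⟨Fin.append x q, ⟨?_, ?_, ?_⟩, ?_⟩
    · simpa only [Fin.append_left] using hx
    · simpa only [Fin.append_right] using hq
    · simpa only [Fin.append_left, Fin.append_right] using hqx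
    · funext i
      simp only [Fin.append_left]
  · rintro ⟨u, ⟨hu, hK', hc⟩, rfl⟩
    exact ⟨hu, _, hK', hc⟩

/-! ### Points (`A = pt`, the volume term) -/

namespace Point

/-- The point with parameter `x ∈ ℝ⁴` is `{x}`. [folklore] -/
def carrier (x : Fin 4 → ℝ) : Set (Fin 4 → ℝ) := {x}

/-- Chart of the space of points: all of `ℝ⁴`. [folklore] -/
def chart : Set (Fin 4 → ℝ) := univ

/-- Density of the invariant (Lebesgue) measure on points: `1`. In the convention of Bernig–Fu the
translation part of the Haar measure of `U(2) ⋉ ℂ²` is Lebesgue measure.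
[cite: BernigFu2011, §2.4] -/
def density (_x : Fin 4 → ℝ) : ℝ := 1

/-- The hitting set of `K` by points. [folklore] -/
def hit (K : Set (Fin 4 → ℝ)) : Set (Fin 4 → ℝ) := hitSet chart carrier K

/-- The hitting set of `K` by points is `K` itself (`μ_pt = vol₄`). [folklore] -/
@[simp] theorem hit_eq (K : Set (Fin 4 → ℝ)) : hit K = K := by
  ext x
  simp only [hit, hitSet, chart, carrier, mem_univ, mem_singleton_iff, true_and, mem_setOf_eq]
  constructor
  · rintro ⟨q, hq, rfl⟩; exact hq
  · intro hx; exact ⟨x, hx, rfl⟩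

/-- The point hitting set of a `ℚ`-semialgebraic body is `ℚ`-semialgebraic. [folklore] -/
theorem isSemialgebraic_hit {K : Set (Fin 4 → ℝ)} (hK : IsSemialgebraic ℚ K) :
    IsSemialgebraic ℚ (hit K) := by
  rw [hit_eq]; exact hK

/-- The point density `1` is a `ℚ`-semialgebraic function on every `ℚ`-semialgebraic set.
[cite: BochnakCosteRoy1998, Def. 2.2.5] -/
theorem isSemialgebraicFunOn_density {s : Set (Fin 4 → ℝ)} (hs : IsSemialgebraic ℚ s) :
    IsSemialgebraicFunOn ℚ s density :=
  (isSemialgebraicFunOn_aeval hs (1 : MvPolynomial (Fin 4) ℚ)).congr fun x _ => by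
    simp [density]

end Point

/-! ### Real lines (`Gr₁ = Gr_{1,0}`, one orbit) -/

namespace RealLine

/-- The real line with parameters `x = (w, c) ∈ ℝ³ × ℝ³`: with `v = (α, β) ∈ S³` the point of
stereographic coordinate `w` and the orthonormal frame `(v, iv, Jv, iJv)`, `Jv = (−β̄, ᾱ)`, it is
`ℝv + c₁ iv + c₂ Jv + c₃ iJv = {q | ⟨q, iv⟩ = c₁, ⟨q, Jv⟩ + i⟨q, iJv⟩ = αz₂ − βz₁ = c₂ + i c₃}`,
written with denominators `D = 1 + |w|²` cleared (`Dα = 2w₀ + 2w₁ i`, `Dβ = 2w₂ + (|w|²−1) i`):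
three real linear equations in `q`. See `mem_carrier_iff_complex`.
[cite: SantaloKac2004, §12.5 (12.39)] -/
def carrier (x : Fin 6 → ℝ) : Set (Fin 4 → ℝ) :=
  {q | 2 * x 0 * q 1 - 2 * x 1 * q 0 + 2 * x 2 * q 3 - (x 0 ^ 2 + x 1 ^ 2 + x 2 ^ 2 - 1) * q 2 =
        (1 + x 0 ^ 2 + x 1 ^ 2 + x 2 ^ 2) * x 3 ∧
      2 * x 0 * q 2 - 2 * x 1 * q 3 - 2 * x 2 * q 0 + (x 0 ^ 2 + x 1 ^ 2 + x 2 ^ 2 - 1) * q 1 =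
        (1 + x 0 ^ 2 + x 1 ^ 2 + x 2 ^ 2) * x 4 ∧
      2 * x 0 * q 3 + 2 * x 1 * q 2 - 2 * x 2 * q 1 - (x 0 ^ 2 + x 1 ^ 2 + x 2 ^ 2 - 1) * q 0 =
        (1 + x 0 ^ 2 + x 1 ^ 2 + x 2 ^ 2) * x 5}

/-- Chart of the space of real lines: directions in the open hemisphere `{Im β < 0} = {|w| < 1}` of
`S³` (each unoriented line whose direction has `Im β ≠ 0` is named exactly once), offsets `c ∈ ℝ³`
arbitrary. [folklore] -/
def chart : Set (Fin 6 → ℝ) := {x | x 0 ^ 2 + x 1 ^ 2 + x 2 ^ 2 < 1}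

/-- Density of the motion-invariant measure on real lines in the chart `(w, c)`:
`dL₁ = dσ₃ ∧ du₃` with `du₃ = (2/D)³ dw` the round measure of `S³` in stereographic coordinates
(the hemisphere `|w| < 1` has mass `π² = O₃/2`, the measure of `ℝP³`) and `dσ₃ = dc` Lebesgue
measure on `v^⊥` in the orthonormal frame `(iv, Jv, iJv)`. Value check:
`μ(lines meeting B⁴) = π² · 4π/3 = 4π³/3`, Santaló's (14.1) with `n = 4`, `r = 1`.
[cite: SantaloKac2004, §12.5 (12.39) and §14.1 (14.1)] -/
def density (x : Fin 6 → ℝ) : ℝ := 8 / (1 + x 0 ^ 2 + x 1 ^ 2 + x 2 ^ 2) ^ 3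

/-- The hitting set `{(w, c) ∈ chart | line(w, c) ∩ K ≠ ∅}` of `K` by real lines. [folklore] -/
def hit (K : Set (Fin 4 → ℝ)) : Set (Fin 6 → ℝ) := hitSet chart carrier K

/-- Membership in the real line `(w, c)`, polynomial form. [folklore] -/
theorem mem_carrier_iff (x : Fin 6 → ℝ) (q : Fin 4 → ℝ) :
    q ∈ carrier x ↔
      2 * x 0 * q 1 - 2 * x 1 * q 0 + 2 * x 2 * q 3 - (x 0 ^ 2 + x 1 ^ 2 + x 2 ^ 2 - 1) * q 2 =
          (1 + x 0 ^ 2 + x 1 ^ 2 + x 2 ^ 2) * x 3 ∧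
        2 * x 0 * q 2 - 2 * x 1 * q 3 - 2 * x 2 * q 0 + (x 0 ^ 2 + x 1 ^ 2 + x 2 ^ 2 - 1) * q 1 =
          (1 + x 0 ^ 2 + x 1 ^ 2 + x 2 ^ 2) * x 4 ∧
        2 * x 0 * q 3 + 2 * x 1 * q 2 - 2 * x 2 * q 1 - (x 0 ^ 2 + x 1 ^ 2 + x 2 ^ 2 - 1) * q 0 =
          (1 + x 0 ^ 2 + x 1 ^ 2 + x 2 ^ 2) * x 5 :=
  Iff.rfl

/-- Membership in the real line `(w, c)`, normalised complex form: with `(α, β) = v(w) ∈ S³`,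
`q ∈ line ↔ Im(z₁ ᾱ + z₂ β̄) = c₁ ∧ α z₂ − β z₁ = c₂ + i c₃`, i.e. `⟨q, iv⟩ = c₁`,
`⟨q, Jv⟩ = c₂`, `⟨q, iJv⟩ = c₃`. [folklore] -/
theorem mem_carrier_iff_complex (x : Fin 6 → ℝ) (q : Fin 4 → ℝ) :
    q ∈ carrier x ↔
      (zfst q * (starRingEnd ℂ) (stereoAlpha x) + zsnd q * (starRingEnd ℂ) (stereoBeta x)).im = x 3 ∧
        stereoAlpha x * zsnd q - stereoBeta x * zfst q = ⟨x 4, x 5⟩ := by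
  have hD : (0 : ℝ) < 1 + x 0 ^ 2 + x 1 ^ 2 + x 2 ^ 2 := by positivity
  have hD' : (1 + x 0 ^ 2 + x 1 ^ 2 + x 2 ^ 2) ≠ 0 := hD.ne'
  rw [mem_carrier_iff]
  simp only [zfst, zsnd, stereoAlpha, stereoBeta, stereoDen, Complex.ext_iff, Complex.mul_re,
    Complex.mul_im, Complex.sub_re, Complex.sub_im, Complex.add_im, Complex.conj_re,
    Complex.conj_im]
  refine and_congr ?_ (and_congr ?_ ?_)
  · rw [← mul_right_inj' hD', eq_comm]
    constructor <;> intro h <;> field_simp at h ⊢ <;> linarith [h]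
  · rw [← mul_right_inj' hD', eq_comm]
    constructor <;> intro h <;> field_simp at h ⊢ <;> linarith [h]
  · rw [← mul_right_inj' hD', eq_comm]
    constructor <;> intro h <;> field_simp at h ⊢ <;> linarith [h]

/-- Membership in the real-line hitting set of `K`. [folklore] -/
theorem mem_hit_iff (K : Set (Fin 4 → ℝ)) (x : Fin 6 → ℝ) :
    x ∈ hit K ↔ x 0 ^ 2 + x 1 ^ 2 + x 2 ^ 2 < 1 ∧ ∃ q ∈ K, q ∈ carrier x := Iff.rfl

/-- The real-line density is positive. [folklore] -/
theorem density_pos (x : Fin 6 → ℝ) : 0 < density x := by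
  unfold density; positivity

/-- The real-line density `8/D³` is a `ℚ`-semialgebraic (rational) function on every
`ℚ`-semialgebraic set. [cite: BochnakCosteRoy1998, Def. 2.2.5] -/
theorem isSemialgebraicFunOn_density {s : Set (Fin 6 → ℝ)} (hs : IsSemialgebraic ℚ s) :
    IsSemialgebraicFunOn ℚ s density := by
  refine (isSemialgebraicFunOn_aeval_div_aeval hs (8 : MvPolynomial (Fin 6) ℚ)
    ((1 + X 0 ^ 2 + X 1 ^ 2 + X 2 ^ 2) ^ 3) fun x _ => ?_).congr fun x _ => ?_
  · simp only [map_pow, map_add, map_one, aeval_X]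
    positivity
  · simp only [density, map_pow, map_add, map_one, map_ofNat, aeval_X]

/-- The chart of real lines is `ℚ`-semialgebraic. [cite: BochnakCosteRoy1998, Def. 2.1.4] -/
theorem isSemialgebraic_chart : IsSemialgebraic ℚ chart := by
  convert isSemialgebraic_setOf_eval_pos (k := ℚ) (R := ℝ)
    (1 - (X 0 ^ 2 + X 1 ^ 2 + X 2 ^ 2) : MvPolynomial (Fin 6) ℚ) using 1
  ext x
  simp [chart, sub_pos]

/-- The incidence relation `{(x, q) | q ∈ line x} ⊆ ℝ¹⁰` is `ℚ`-semialgebraic (three polynomial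
equations). [cite: BochnakCosteRoy1998, Def. 2.1.4] -/
theorem isSemialgebraic_incidence :
    IsSemialgebraic ℚ {u : Fin (6 + 4) → ℝ |
      (fun j : Fin 4 => u (Fin.natAdd 6 j)) ∈ carrier (fun i : Fin 6 => u (Fin.castAdd 4 i))} := by
  let x : Fin 6 → MvPolynomial (Fin (6 + 4)) ℚ := fun i => X (Fin.castAdd 4 i)
  let q : Fin 4 → MvPolynomial (Fin (6 + 4)) ℚ := fun j => X (Fin.natAdd 6 j)
  have h1 := isSemialgebraic_setOf_eval_eq_zero (k := ℚ) (R := ℝ)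
    (2 * x 0 * q 1 - 2 * x 1 * q 0 + 2 * x 2 * q 3 - (x 0 ^ 2 + x 1 ^ 2 + x 2 ^ 2 - 1) * q 2 -
      (1 + x 0 ^ 2 + x 1 ^ 2 + x 2 ^ 2) * x 3)
  have h2 := isSemialgebraic_setOf_eval_eq_zero (k := ℚ) (R := ℝ)
    (2 * x 0 * q 2 - 2 * x 1 * q 3 - 2 * x 2 * q 0 + (x 0 ^ 2 + x 1 ^ 2 + x 2 ^ 2 - 1) * q 1 -
      (1 + x 0 ^ 2 + x 1 ^ 2 + x 2 ^ 2) * x 4)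
  have h3 := isSemialgebraic_setOf_eval_eq_zero (k := ℚ) (R := ℝ)
    (2 * x 0 * q 3 + 2 * x 1 * q 2 - 2 * x 2 * q 1 - (x 0 ^ 2 + x 1 ^ 2 + x 2 ^ 2 - 1) * q 0 -
      (1 + x 0 ^ 2 + x 1 ^ 2 + x 2 ^ 2) * x 5)
  convert h1.inter (h2.inter h3) using 1
  ext u
  simp only [mem_setOf_eq, mem_carrier_iff, mem_inter_iff, x, q, map_sub, map_add, map_mul,
    map_pow, map_ofNat, map_one, aeval_X, sub_eq_zero]

/-- **The real-line hitting set of a `ℚ`-semialgebraic body is `ℚ`-semialgebraic.**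
[cite: BochnakCosteRoy1998, Thm. 2.2.1] -/
theorem isSemialgebraic_hit {K : Set (Fin 4 → ℝ)} (hK : IsSemialgebraic ℚ K) :
    IsSemialgebraic ℚ (hit K) :=
  isSemialgebraic_hitSet isSemialgebraic_chart isSemialgebraic_incidence hK

end RealLine

/-! ### Complex affine lines (`Gr_{2,1}`) -/

namespace ComplexLine

/-- The complex affine line with parameters `x = (m, c) ∈ ℂ × ℂ = ℝ⁴` (`m = x 0 + i x 1`,
`c = x 2 + i x 3`): `{(z₁, z₂) | z₂ = m z₁ + c}`, as two real equations. See
`mem_carrier_iff_complex`. [cite: BernigFu2011, §2.2] -/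
def carrier (x : Fin 4 → ℝ) : Set (Fin 4 → ℝ) :=
  {q | q 2 = x 0 * q 0 - x 1 * q 1 + x 2 ∧ q 3 = x 0 * q 1 + x 1 * q 0 + x 3}

/-- Chart of the space of complex affine lines: all `(m, c) ∈ ℝ⁴` (every complex line not parallel to
`ℂe₂`, a co-null open set of the homogeneous space). [folklore] -/
def chart : Set (Fin 4 → ℝ) := univ

/-- Density of the `U(2) ⋉ ℂ²`-invariant measure on complex affine lines in the chart `(m, c)`:
`(1 + |m|²)⁻³ = ` (Fubini–Study area form `dm/(1+|m|²)²` of `ℂP¹ ∋ [1 : m]`, total mass `π`) ⊗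
(Lebesgue measure on the orthogonal complex line, Jacobian `(1+|m|²)⁻¹` of the intercept `c`).
Value checks: `μ(lines meeting B⁴) = π²`; unit complex disc `π²/2`; unit Lagrangian disc `π²/4`
(Haar means `1/2`, `1/4` of `UnitaryDiscPair`); `μ/π` is the probability normalisation of the
Crofton measure `ν_{2,1}`. [cite: BernigFu2011, §2.2 and §4] -/
def density (x : Fin 4 → ℝ) : ℝ := 1 / (1 + x 0 ^ 2 + x 1 ^ 2) ^ 3

/-- The hitting set `{(m, c) | {z₂ = m z₁ + c} ∩ K ≠ ∅}` of `K` by complex lines. [folklore] -/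
def hit (K : Set (Fin 4 → ℝ)) : Set (Fin 4 → ℝ) := hitSet chart carrier K

/-- Membership in the complex line `(m, c)`, real form. [folklore] -/
theorem mem_carrier_iff (x : Fin 4 → ℝ) (q : Fin 4 → ℝ) :
    q ∈ carrier x ↔ q 2 = x 0 * q 0 - x 1 * q 1 + x 2 ∧ q 3 = x 0 * q 1 + x 1 * q 0 + x 3 :=
  Iff.rfl

/-- Membership in the complex line `(m, c)`, complex form: `z₂ = m z₁ + c`. [folklore] -/
theorem mem_carrier_iff_complex (x : Fin 4 → ℝ) (q : Fin 4 → ℝ) :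
    q ∈ carrier x ↔ zsnd q = ⟨x 0, x 1⟩ * zfst q + ⟨x 2, x 3⟩ := by
  rw [mem_carrier_iff]
  simp only [zfst, zsnd, Complex.ext_iff, Complex.mul_re, Complex.mul_im, Complex.add_re,
    Complex.add_im]

/-- Membership in the complex-line hitting set of `K`. [folklore] -/
theorem mem_hit_iff (K : Set (Fin 4 → ℝ)) (x : Fin 4 → ℝ) :
    x ∈ hit K ↔ ∃ q ∈ K, q ∈ carrier x := by
  simp [hit, hitSet, chart]

/-- The complex-line density is positive. [folklore] -/
theorem density_pos (x : Fin 4 → ℝ) : 0 < density x := by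
  unfold density; positivity

/-- The complex-line density `(1+|m|²)⁻³` is a `ℚ`-semialgebraic (rational) function on every
`ℚ`-semialgebraic set. [cite: BochnakCosteRoy1998, Def. 2.2.5] -/
theorem isSemialgebraicFunOn_density {s : Set (Fin 4 → ℝ)} (hs : IsSemialgebraic ℚ s) :
    IsSemialgebraicFunOn ℚ s density := by
  refine (isSemialgebraicFunOn_aeval_div_aeval hs (1 : MvPolynomial (Fin 4) ℚ)
    ((1 + X 0 ^ 2 + X 1 ^ 2) ^ 3) fun x _ => ?_).congr fun x _ => ?_
  · simp only [map_pow, map_add, map_one, aeval_X]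
    positivity
  · simp only [density, map_pow, map_add, map_one, aeval_X]

/-- The incidence relation `{(x, q) | q ∈ complex line x} ⊆ ℝ⁸` is `ℚ`-semialgebraic.
[cite: BochnakCosteRoy1998, Def. 2.1.4] -/
theorem isSemialgebraic_incidence :
    IsSemialgebraic ℚ {u : Fin (4 + 4) → ℝ |
      (fun j : Fin 4 => u (Fin.natAdd 4 j)) ∈ carrier (fun i : Fin 4 => u (Fin.castAdd 4 i))} := by
  let x : Fin 4 → MvPolynomial (Fin (4 + 4)) ℚ := fun i => X (Fin.castAdd 4 i)
  let q : Fin 4 → MvPolynomial (Fin (4 + 4)) ℚ := fun j => X (Fin.natAdd 4 j)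
  have h1 := isSemialgebraic_setOf_eval_eq_zero (k := ℚ) (R := ℝ)
    (q 2 - (x 0 * q 0 - x 1 * q 1 + x 2))
  have h2 := isSemialgebraic_setOf_eval_eq_zero (k := ℚ) (R := ℝ)
    (q 3 - (x 0 * q 1 + x 1 * q 0 + x 3))
  convert h1.inter h2 using 1
  ext u
  simp only [mem_setOf_eq, mem_carrier_iff, mem_inter_iff, x, q, map_sub, map_add, map_mul,
    aeval_X, sub_eq_zero]

/-- **The complex-line hitting set of a `ℚ`-semialgebraic body is `ℚ`-semialgebraic.**
[cite: BochnakCosteRoy1998, Thm. 2.2.1] -/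
theorem isSemialgebraic_hit {K : Set (Fin 4 → ℝ)} (hK : IsSemialgebraic ℚ K) :
    IsSemialgebraic ℚ (hit K) :=
  isSemialgebraic_hitSet (by unfold chart; exact isSemialgebraic_univ) isSemialgebraic_incidence hK

end ComplexLine

/-! ### Affine Lagrangian planes (`Gr_{2,0}`) -/

namespace LagrangianPlane

/-- The affine Lagrangian plane with parameters `x = (s₁, s₂, s₃, c₁, c₂) ∈ ℝ⁵`,
`S = [[s₁, s₂], [s₂, s₃]]` real symmetric: `{u + i(Su + c) | u ∈ ℝ²}`, i.e.
`Im z = S Re z + c` — `q 1 = s₁ q 0 + s₂ q 2 + c₁`, `q 3 = s₂ q 0 + s₃ q 2 + c₂`. The graph of `S`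
is Lagrangian for the Kähler form of `ℂ²` exactly when `S` is symmetric; every affine Lagrangian
plane transversal to `iℝ²` is of this form for a unique `x`. [cite: BernigFu2011, §2.2] -/
def carrier (x : Fin 5 → ℝ) : Set (Fin 4 → ℝ) :=
  {q | q 1 = x 0 * q 0 + x 1 * q 2 + x 3 ∧ q 3 = x 1 * q 0 + x 2 * q 2 + x 4}

/-- Chart of the space of affine Lagrangian planes: all of `ℝ⁵` (the planes transversal to `iℝ²`,
a co-null open subset of the rank-2 bundle over `Λ(2) = U(2)/O(2)`). [folklore] -/
def chart : Set (Fin 5 → ℝ) := univ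

/-- Density of the `U(2) ⋉ ℂ²`-invariant measure on affine Lagrangian planes in the graph chart:
`det(1 + S²)⁻² = ((1 − s₁s₃ + s₂²)² + (s₁ + s₃)²)⁻²` (`det(1+S²) = |det(1 + iS)|²`). It is
(the `U(2)`-invariant measure on `Λ(2)` with chart density `det(1+S²)^{-3/2}`, total mass `π²`;
Cayley image `W = (1+iS)(1−iS)⁻¹` of the invariant measure on symmetric unitary matrices, metric
`tr(dW dW*) = 4 tr((1+S²)⁻¹dS(1+S²)⁻¹dS)`) ⊗ (Lebesgue measure on `L^⊥ = iL`, Jacobian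
`det(1+S²)^{-1/2}` of the offset `c`). Exact value checks (module docstring):
`μ(planes meeting B⁴) = π³`, unit complex disc `π³/4`, unit Lagrangian disc `3π³/8`, matching the
Haar means `1/4`, `3/8` on the group side; `μ/π²` is the probability normalisation of the Crofton
measure `ν_{2,0}`. [folklore] -/
def density (x : Fin 5 → ℝ) : ℝ := 1 / ((1 - x 0 * x 2 + x 1 ^ 2) ^ 2 + (x 0 + x 2) ^ 2) ^ 2

/-- The hitting set `{(S, c) | {Im z = S Re z + c} ∩ K ≠ ∅}` of `K` by affine Lagrangian planes.
[folklore] -/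
def hit (K : Set (Fin 4 → ℝ)) : Set (Fin 5 → ℝ) := hitSet chart carrier K

/-- Membership in the Lagrangian plane `(S, c)`. [folklore] -/
theorem mem_carrier_iff (x : Fin 5 → ℝ) (q : Fin 4 → ℝ) :
    q ∈ carrier x ↔ q 1 = x 0 * q 0 + x 1 * q 2 + x 3 ∧ q 3 = x 1 * q 0 + x 2 * q 2 + x 4 :=
  Iff.rfl

/-- Membership in the Lagrangian-plane hitting set of `K`. [folklore] -/
theorem mem_hit_iff (K : Set (Fin 4 → ℝ)) (x : Fin 5 → ℝ) :
    x ∈ hit K ↔ ∃ q ∈ K, q ∈ carrier x := by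
  simp [hit, hitSet, chart]

/-- `det(1 + S²) = (1 − det S)² + (tr S)² > 0`. [folklore] -/
theorem det_pos (x : Fin 5 → ℝ) : 0 < (1 - x 0 * x 2 + x 1 ^ 2) ^ 2 + (x 0 + x 2) ^ 2 := by
  rcases eq_or_ne (x 0 + x 2) 0 with h | h
  · have hx2 : x 2 = -x 0 := by linarith
    have h1 : 0 < 1 - x 0 * x 2 + x 1 ^ 2 := by
      rw [hx2]; nlinarith [sq_nonneg (x 0), sq_nonneg (x 1)]
    exact add_pos_of_pos_of_nonneg (pow_pos h1 2) (sq_nonneg _)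
  · exact add_pos_of_nonneg_of_pos (sq_nonneg _)
      (lt_of_le_of_ne (sq_nonneg _) (Ne.symm (pow_ne_zero 2 h)))

/-- The Lagrangian-plane density is positive. [folklore] -/
theorem density_pos (x : Fin 5 → ℝ) : 0 < density x := by
  unfold density
  have := det_pos x
  positivity

/-- The Lagrangian-plane density `det(1+S²)⁻²` is a `ℚ`-semialgebraic (rational) function on every
`ℚ`-semialgebraic set. [cite: BochnakCosteRoy1998, Def. 2.2.5] -/
theorem isSemialgebraicFunOn_density {s : Set (Fin 5 → ℝ)} (hs : IsSemialgebraic ℚ s) :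
    IsSemialgebraicFunOn ℚ s density := by
  refine (isSemialgebraicFunOn_aeval_div_aeval hs (1 : MvPolynomial (Fin 5) ℚ)
    (((1 - X 0 * X 2 + X 1 ^ 2) ^ 2 + (X 0 + X 2) ^ 2) ^ 2) fun x _ => ?_).congr fun x _ => ?_
  · simp only [map_pow, map_add, map_sub, map_mul, map_one, aeval_X]
    exact (pow_pos (det_pos x) 2).ne'
  · simp only [density, map_pow, map_add, map_sub, map_mul, map_one, aeval_X]

/-- The incidence relation `{(x, q) | q ∈ Lagrangian plane x} ⊆ ℝ⁹` is `ℚ`-semialgebraic.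
[cite: BochnakCosteRoy1998, Def. 2.1.4] -/
theorem isSemialgebraic_incidence :
    IsSemialgebraic ℚ {u : Fin (5 + 4) → ℝ |
      (fun j : Fin 4 => u (Fin.natAdd 5 j)) ∈ carrier (fun i : Fin 5 => u (Fin.castAdd 4 i))} := by
  let x : Fin 5 → MvPolynomial (Fin (5 + 4)) ℚ := fun i => X (Fin.castAdd 4 i)
  let q : Fin 4 → MvPolynomial (Fin (5 + 4)) ℚ := fun j => X (Fin.natAdd 5 j)
  have h1 := isSemialgebraic_setOf_eval_eq_zero (k := ℚ) (R := ℝ)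
    (q 1 - (x 0 * q 0 + x 1 * q 2 + x 3))
  have h2 := isSemialgebraic_setOf_eval_eq_zero (k := ℚ) (R := ℝ)
    (q 3 - (x 1 * q 0 + x 2 * q 2 + x 4))
  convert h1.inter h2 using 1
  ext u
  simp only [mem_setOf_eq, mem_carrier_iff, mem_inter_iff, x, q, map_sub, map_add, map_mul,
    aeval_X, sub_eq_zero]

/-- **The Lagrangian-plane hitting set of a `ℚ`-semialgebraic body is `ℚ`-semialgebraic.**
[cite: BochnakCosteRoy1998, Thm. 2.2.1] -/
theorem isSemialgebraic_hit {K : Set (Fin 4 → ℝ)} (hK : IsSemialgebraic ℚ K) :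
    IsSemialgebraic ℚ (hit K) :=
  isSemialgebraic_hitSet (by unfold chart; exact isSemialgebraic_univ) isSemialgebraic_incidence hK

end LagrangianPlane

/-! ### Real hyperplanes (`Gr₃ = Gr_{3,1}`, one orbit) -/

namespace RealHyperplane

/-- The real hyperplane with parameters `x = (w, p) ∈ ℝ³ × ℝ`: unit normal `v(w) = (α, β) ∈ S³`
(stereographic coordinate `w`), distance `p` from the origin: `{q | ⟨q, v(w)⟩ = p}`, with the
denominator `D = 1 + |w|²` cleared:
`2w₀ q₀ + 2w₁ q₁ + 2w₂ q₂ + (|w|² − 1) q₃ = D p`. [cite: SantaloKac2004, §12.5 (12.40)] -/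
def carrier (x : Fin 4 → ℝ) : Set (Fin 4 → ℝ) :=
  {q | 2 * x 0 * q 0 + 2 * x 1 * q 1 + 2 * x 2 * q 2 + (x 0 ^ 2 + x 1 ^ 2 + x 2 ^ 2 - 1) * q 3 =
    (1 + x 0 ^ 2 + x 1 ^ 2 + x 2 ^ 2) * x 3}

/-- Chart of the space of real hyperplanes: all normals `w ∈ ℝ³` (every unit normal but the pole
`(0, i)`), distances `p = x 3 ≥ 0` (hyperplanes through the origin are named twice, a null set; the
convention of `LineHit` in the plane engine). [folklore] -/
def chart : Set (Fin 4 → ℝ) := {x | 0 ≤ x 3}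

/-- Density of the motion-invariant measure on real hyperplanes in the chart `(w, p)`:
`dL₃ = dp ∧ du₃`, `du₃ = (2/D)³ dw` the round measure of `S³` (total mass `2π² = O₃`).
Value check: `μ(hyperplanes meeting B⁴) = 2π²`, Santaló's (14.1) with `n = 4`, `r = 3`
(`= 4 W₃(B⁴)`); in general `μ(K) = π² · (mean width of K)`.
[cite: SantaloKac2004, §12.5 (12.40) and §14.1 (14.1)] -/
def density (x : Fin 4 → ℝ) : ℝ := 8 / (1 + x 0 ^ 2 + x 1 ^ 2 + x 2 ^ 2) ^ 3

/-- The hitting set `{(w, p) | p ≥ 0, {⟨q, v(w)⟩ = p} ∩ K ≠ ∅}` of `K` by real hyperplanes.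
[folklore] -/
def hit (K : Set (Fin 4 → ℝ)) : Set (Fin 4 → ℝ) := hitSet chart carrier K

/-- Membership in the hyperplane `(w, p)`, polynomial form. [folklore] -/
theorem mem_carrier_iff (x : Fin 4 → ℝ) (q : Fin 4 → ℝ) :
    q ∈ carrier x ↔
      2 * x 0 * q 0 + 2 * x 1 * q 1 + 2 * x 2 * q 2 + (x 0 ^ 2 + x 1 ^ 2 + x 2 ^ 2 - 1) * q 3 =
        (1 + x 0 ^ 2 + x 1 ^ 2 + x 2 ^ 2) * x 3 :=
  Iff.rfl

/-- Membership in the hyperplane `(w, p)`, normalised form `⟨q, v(w)⟩ = p` with the unit normal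
`v(w) = (Re α, Im α, Re β, Im β)`. [folklore] -/
theorem mem_carrier_iff_unit (x : Fin 4 → ℝ) (q : Fin 4 → ℝ) :
    q ∈ carrier x ↔
      (stereoAlpha x).re * q 0 + (stereoAlpha x).im * q 1 + (stereoBeta x).re * q 2 +
        (stereoBeta x).im * q 3 = x 3 := by
  have hD : (0 : ℝ) < 1 + x 0 ^ 2 + x 1 ^ 2 + x 2 ^ 2 := by positivity
  have hD' : (1 + x 0 ^ 2 + x 1 ^ 2 + x 2 ^ 2) ≠ 0 := hD.ne'
  rw [mem_carrier_iff]
  simp only [stereoAlpha, stereoBeta, stereoDen]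
  rw [← mul_right_inj' hD', eq_comm]
  constructor <;> intro h <;> field_simp at h ⊢ <;> linarith [h]

/-- Membership in the hyperplane hitting set of `K`. [folklore] -/
theorem mem_hit_iff (K : Set (Fin 4 → ℝ)) (x : Fin 4 → ℝ) :
    x ∈ hit K ↔ 0 ≤ x 3 ∧ ∃ q ∈ K, q ∈ carrier x := Iff.rfl

/-- The hyperplane density is positive. [folklore] -/
theorem density_pos (x : Fin 4 → ℝ) : 0 < density x := by
  unfold density; positivity

/-- The hyperplane density `8/D³` is a `ℚ`-semialgebraic (rational) function on every
`ℚ`-semialgebraic set. [cite: BochnakCosteRoy1998, Def. 2.2.5] -/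
theorem isSemialgebraicFunOn_density {s : Set (Fin 4 → ℝ)} (hs : IsSemialgebraic ℚ s) :
    IsSemialgebraicFunOn ℚ s density := by
  refine (isSemialgebraicFunOn_aeval_div_aeval hs (8 : MvPolynomial (Fin 4) ℚ)
    ((1 + X 0 ^ 2 + X 1 ^ 2 + X 2 ^ 2) ^ 3) fun x _ => ?_).congr fun x _ => ?_
  · simp only [map_pow, map_add, map_one, aeval_X]
    positivity
  · simp only [density, map_pow, map_add, map_one, map_ofNat, aeval_X]

/-- The chart of real hyperplanes is `ℚ`-semialgebraic. [cite: BochnakCosteRoy1998, Def. 2.1.4] -/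
theorem isSemialgebraic_chart : IsSemialgebraic ℚ chart := by
  have h := isSemialgebraic_setOf_eval_nonneg (k := ℚ) (R := ℝ) (X 3 : MvPolynomial (Fin 4) ℚ)
  have e : chart = {x : Fin 4 → ℝ | 0 ≤ aeval x (X 3 : MvPolynomial (Fin 4) ℚ)} := by
    ext x
    simp [chart]
  rw [e]
  exact h

/-- The incidence relation `{(x, q) | q ∈ hyperplane x} ⊆ ℝ⁸` is `ℚ`-semialgebraic.
[cite: BochnakCosteRoy1998, Def. 2.1.4] -/
theorem isSemialgebraic_incidence :
    IsSemialgebraic ℚ {u : Fin (4 + 4) → ℝ |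
      (fun j : Fin 4 => u (Fin.natAdd 4 j)) ∈ carrier (fun i : Fin 4 => u (Fin.castAdd 4 i))} := by
  let x : Fin 4 → MvPolynomial (Fin (4 + 4)) ℚ := fun i => X (Fin.castAdd 4 i)
  let q : Fin 4 → MvPolynomial (Fin (4 + 4)) ℚ := fun j => X (Fin.natAdd 4 j)
  have h1 := isSemialgebraic_setOf_eval_eq_zero (k := ℚ) (R := ℝ)
    (2 * x 0 * q 0 + 2 * x 1 * q 1 + 2 * x 2 * q 2 + (x 0 ^ 2 + x 1 ^ 2 + x 2 ^ 2 - 1) * q 3 -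
      (1 + x 0 ^ 2 + x 1 ^ 2 + x 2 ^ 2) * x 3)
  convert h1 using 1
  ext u
  simp only [mem_setOf_eq, mem_carrier_iff, x, q, map_sub, map_add, map_mul, map_pow, map_ofNat,
    map_one, aeval_X, sub_eq_zero]

/-- **The hyperplane hitting set of a `ℚ`-semialgebraic body is `ℚ`-semialgebraic.**
[cite: BochnakCosteRoy1998, Thm. 2.2.1] -/
theorem isSemialgebraic_hit {K : Set (Fin 4 → ℝ)} (hK : IsSemialgebraic ℚ K) :
    IsSemialgebraic ℚ (hit K) :=
  isSemialgebraic_hitSet isSemialgebraic_chart isSemialgebraic_incidence hK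

end RealHyperplane

/-! ### Hermitian hitting representations -/

/-- A **hermitian hitting representation** of a body `K ⊆ ℂ² = ℝ⁴`: for each of the five orbit
types `A ∈ {pt, real line, complex line, Lagrangian plane, real hyperplane}` of real affine
subspaces of `ℂ²` under `U(2) ⋉ ℂ²`, an integral representation of the Kontsevich–Zagier calculus
whose domain is the hitting set `hit_A K = {E of type A | E ∩ K ≠ ∅}` in the chart of this file and
whose integrand is the invariant density `density_A` there; its value is the hitting integral
`μ_A(K) = m_A{E | E ∩ K ≠ ∅}`. For convex `K` these are, in the notation of Bernig–Fu (`ν_{k,p}` =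
the valuation whose Crofton measure is the `U(2)`-invariant probability measure on `Gr_{k,p}`,
`ν(K) = ∫ vol_k(π_E K) dprob(E)`): `vol₄(K)`, `π² ν_{3,1}(K)`, `π ν_{2,1}(K)`, `π² ν_{2,0}(K)`,
`π² ν_{1,0}(K) = π² · (mean width)` — with `χ`, a spanning set of the 6-dimensional `Val^{U(2)}`.
This is the shape in which hitting sets are quantified over in route KinematicFormulas
(`LineHit`, `Inc`). [cite: BernigFu2011, §2.2, §2.4 and §4] -/
structure HermitianHittingRep (K : Set (Fin 4 → ℝ)) where
  /-- `[K, 1]`: the volume term. -/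
  point : KZ.IntegralRep 4
  /-- `[RealLine.hit K, 8/D³]`. -/
  realLine : KZ.IntegralRep 6
  /-- `[ComplexLine.hit K, (1+|m|²)⁻³]`. -/
  complexLine : KZ.IntegralRep 4
  /-- `[LagrangianPlane.hit K, det(1+S²)⁻²]`. -/
  lagrangianPlane : KZ.IntegralRep 5
  /-- `[RealHyperplane.hit K, 8/D³]`. -/
  realHyperplane : KZ.IntegralRep 4
  /-- The domain of the point representation is `Point.hit K = K`. -/
  point_domain : point.domain = Point.hit K
  /-- The integrand of the point representation is `1` on the domain. -/
  point_integrand : EqOn point.integrand Point.density point.domain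
  /-- The domain of the real-line representation is the real-line hitting set. -/
  realLine_domain : realLine.domain = RealLine.hit K
  /-- The integrand of the real-line representation is the invariant density. -/
  realLine_integrand : EqOn realLine.integrand RealLine.density realLine.domain
  /-- The domain of the complex-line representation is the complex-line hitting set. -/
  complexLine_domain : complexLine.domain = ComplexLine.hit K
  /-- The integrand of the complex-line representation is the invariant density. -/
  complexLine_integrand : EqOn complexLine.integrand ComplexLine.density complexLine.domain
  /-- The domain of the Lagrangian-plane representation is the Lagrangian hitting set. -/
  lagrangianPlane_domain : lagrangianPlane.domain = LagrangianPlane.hit K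
  /-- The integrand of the Lagrangian-plane representation is the invariant density. -/
  lagrangianPlane_integrand :
    EqOn lagrangianPlane.integrand LagrangianPlane.density lagrangianPlane.domain
  /-- The domain of the hyperplane representation is the hyperplane hitting set. -/
  realHyperplane_domain : realHyperplane.domain = RealHyperplane.hit K
  /-- The integrand of the hyperplane representation is the invariant density. -/
  realHyperplane_integrand :
    EqOn realHyperplane.integrand RealHyperplane.density realHyperplane.domain

namespace HermitianHittingRep

variable {K : Set (Fin 4 → ℝ)}

/-- The body of a hermitian hitting representation is `ℚ`-semialgebraic (it is the domain of the
point representation). [cite: KontsevichZagier2001, §1.1] -/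
theorem isSemialgebraic (R : HermitianHittingRep K) : IsSemialgebraic ℚ K := by
  simpa [R.point_domain] using R.point.isSemialgebraic_domain

/-- The value of the point representation is the volume of the body: `μ_pt(K) = vol₄ K`.
[cite: BernigFu2011, §2.4] -/
theorem point_value (R : HermitianHittingRep K) : R.point.value = (volume K).toReal := by
  have hdom : R.point.domain = K := by simpa using R.point_domain
  have hmeas : MeasurableSet R.point.domain := KZ.IntegralRep.measurableSet_domain_holds R.point
  rw [KZ.IntegralRep.value, setIntegral_congr_fun hmeas R.point_integrand, hdom]
  simp [Point.density, Measure.real]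

end HermitianHittingRep

end C2

end Literature.Geometry.IntegralGeometry
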